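import Literature.AlgebraicGeometry.Modules.PullbackFlatMono
import Mathlib.AlgebraicGeometry.Morphisms.Flat
import Mathlib.RingTheory.IsTensorProduct
import Mathlib.Algebra.Category.Ring.Constructions
import HarnessLib

/-!
# Affine base change of the sections of a quasi-coherent module:
# `Γ(U_T) ⊗_{Γ(U_S)} Γ(U_X, M) ≅ Γ(U_Y, g^*M)` over three affine opens of a cartesian square

Layer `Literature/AlgebraicGeometry/Modules`. For a CARTESIAN square of schemes
```
Y ——g——→ X
|iY       |iX
T ——f——→ S
```
affine opens `U_S ⊆ S`, `U_T ⊆ f⁻¹U_S`, `U_X ⊆ i_X⁻¹U_S`, the (affine) open `U_Y := g⁻¹U_X ∩ i_Y⁻¹U_T` of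
`Y = X ×_S T`, and an affine-localizing (e.g. quasi-coherent, `IsAffineLocalizing.of_isQuasicoherent`)
`𝒪_X`-module `M`, this file PROVES (no definition, no named fact, no instance, no `sorry`):

* `isPushout_sections_of_isPullback` — `Γ(U_Y, 𝒪_Y) = Γ(U_T) ⊗_{Γ(U_S)} Γ(U_X)` in the unbundled form
  `Algebra.IsPushout Γ(U_S) Γ(U_T) Γ(U_X) Γ(U_Y)`, for ANY algebra structures whose structure maps are
  `f♯`, `i_X♯`, `g♯`, `i_Y♯` (Mathlib's `isIso_pushoutSection_of_isAffineOpen`, Görtz–Wedhorn I Prop. 4.16,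
  transported through `CommRingCat.isPushout_iff_isPushout`);
* **`exists_linearEquiv_tensor_sections_pullback`** — **`Γ(U_T) ⊗_{Γ(U_S)} Γ(U_X, M) ≃ₗ[Γ(U_T)] Γ(U_Y, g^*M)`,
  `t ⊗ m ↦ t · η(m)|_{U_Y}`** (`η(m)|` = the tree's `unitSectionLE`, the pulled-back section), again for any
  `Γ(U_S)`-module structure on `Γ(U_X, M)` through `i_X♯` and any `Γ(U_T)`-module structure on
  `Γ(U_Y, g^*M)` through `i_Y♯` (hypotheses `hf`, `hiX`, `hiY`).  This is Görtz–Wedhorn I, Prop. 7.24 (2) /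
  Rem. 7.25 «`Γ(f⁻¹V ∩ U, f^*𝓕) = Γ(U, 𝒪_X) ⊗_{Γ(V, 𝒪_Y)} Γ(V, 𝓕)` for affine `U`, `V`» combined with the
  affine base change of the structure sheaf; in the fibre-product form it is the displayed formula
  `𝓕(V) ⊗_A A' = 𝓕'(u'⁻¹(V))` of Görtz–Wedhorn II, proof of Thm. 22.90 (p. 388), and the affine case of
  Stacks 02KH.  Proof: the tree's chart isomorphism `chartSectionsEquiv : Γ(U_Y) ⊗_{Γ(U_X)} Γ(U_X, M) ≃
  Γ(U_Y, g^*M)` (`Modules/PullbackAffineChart`, `chartSectionsEquiv_tmul` of `Modules/PullbackFlatMono`),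
  the ring pushout above, and Mathlib's `Algebra.IsPushout.cancelBaseChange :
  (Γ(U_T) ⊗_{Γ(U_S)} Γ(U_X)) ⊗_{Γ(U_X)} N ≃ Γ(U_T) ⊗_{Γ(U_S)} N`; the candidate map is written down
  directly (`TensorProduct.AlgebraTensorModule.lift`) and shown to agree with that composite of bijections;
* `unitSectionLE_map_of_le`, **`map_tensor_sections_pullback_natural`** — NATURALITY in the open of `X`:
  for `U_X' ⊆ U_X` the isomorphisms (indeed any two maps pinned by the formula `t ⊗ m ↦ t · η(m)|`)
  commute with the restrictions `Γ(U_X, M) → Γ(U_X', M)`, `Γ(U_Y, g^*M) → Γ(U_Y', g^*M)`, so that over a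
  finite affine cover `s ↦ U_{X,s}` of `X|_{U_S}` they assemble to an isomorphism of ordered Čech complexes
  `Γ(U_T) ⊗_{Γ(U_S)} Č•(𝔘, M) ≅ Č•(g⁻¹𝔘 ∩ i_Y⁻¹U_T, g^*M)` (the assembly is the consumer's).

Typical instance: `S = Spec K`, `X` a `K`-scheme, `T' → T` a morphism of affine `K`-schemes and the
cartesian square `X ×_K T' → X ×_K T` over it (the tree's `Motives.isPullback_whiskerLeft_snd`), with
`U_S := U` an affine open of `T` and `U_T := ⊤`: «sections of `L_{T'}` over `Wᵢ ×_T T'` are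
`Γ(Wᵢ, L) ⊗_{Γ(U)} Γ(T')`» — the base-change step of cohomology-and-base-change arguments over a possibly
non-reduced base (Mumford, *Abelian Varieties* §5; Görtz–Wedhorn II (23.28.5)).  Cell `hodgecm-mathlib`,
M13 phase A, node N1 (1a-β) (B-plan1 R84; consumer B-p01/B-p10's module Čech complex (1a-α)); generic
leaf, books 0; HC_CM is proved only modulo the printed citations until rung 0 closes.

Mathlib searched (pin v4.32): `isIso_pushoutSection_of_isAffineOpen`, `isIso_pushoutSection_iff`,
`CommRingCat.isPushout_iff_isPushout`, `Algebra.IsPushout.cancelBaseChange(_symm_tmul)`,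
`TensorProduct.AlgebraTensorModule.lift`, `LinearMap.mk₂'`, `TensorProduct.congr`, `LinearEquiv.ofBijective`
(used); Mathlib's `Scheme.Modules.pullback` is an abstract left adjoint with no sections formula (the tree's
`Modules/PullbackAffineChart` supplies the chart one).

## References

* U. Görtz, T. Wedhorn, *Algebraic Geometry I: Schemes*, 2nd ed., Springer Spektrum (2020): Prop. 7.24 (2),
  Rem. 7.25; Prop. 4.16 and (4.8) (fibre products, pp. 101–104). [GortzWedhorn2020]
* U. Görtz, T. Wedhorn, *Algebraic Geometry II: Cohomology of Schemes*, Springer Spektrum (2023): proof of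
  Thm. 22.90 (p. 388), (23.28.5) (p. 482). [GortzWedhorn2023]
* The Stacks Project, Tag 02KH (Lemma 30.5.2, flat base change; affine case), Tag 01I8. [StacksProject]
* D. Mumford, *Abelian Varieties* (1970), §5 (cohomology and base change). [MumfordAV1970]
-/

noncomputable section

-- `TopCat.Presheaf`/`Scheme.Modules` are not reducible (as in Mathlib's `AlgebraicGeometry/Modules`).
set_option backward.isDefEq.respectTransparency false

open CategoryTheory CategoryTheory.Limits AlgebraicGeometry TopologicalSpace Opposite TensorProduct
open scoped ChangeOfRings

universe u

namespace Literature.AlgebraicGeometry.Modules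

section Square

variable {X Y S T : Scheme.{u}} {f : T ⟶ S} {g : Y ⟶ X} {iX : X ⟶ S} {iY : Y ⟶ T}
  {US : S.Opens} {UT : T.Opens} {UX : X.Opens} {UY : Y.Opens}

/-- `U_Y ≤ g⁻¹ U_X`. [cite: GortzWedhorn2020, Prop. 4.16 (pp. 101–104)] -/
theorem le_preimage_left_of_eq_inf (hUY : UY = g ⁻¹ᵁ UX ⊓ iY ⁻¹ᵁ UT) : UY ≤ g ⁻¹ᵁ UX :=
  hUY.trans_le inf_le_left

/-- `U_Y ≤ i_Y⁻¹ U_T`. [cite: GortzWedhorn2020, Prop. 4.16 (pp. 101–104)] -/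
theorem le_preimage_right_of_eq_inf (hUY : UY = g ⁻¹ᵁ UX ⊓ iY ⁻¹ᵁ UT) : UY ≤ iY ⁻¹ᵁ UT :=
  hUY.trans_le inf_le_right

/-- The ring square on sections of a commutative square `g ≫ i_X = i_Y ≫ f`:
`g♯ ∘ i_X♯ = i_Y♯ ∘ f♯ : Γ(U_S) → Γ(U_Y)`. [cite: GortzWedhorn2020, Prop. 4.16 (pp. 101–104)] -/
theorem appLE_comp_appLE_eq_of_comm_sq (w : g ≫ iX = iY ≫ f) (hUST : UT ≤ f ⁻¹ᵁ US)
    (hUSX : UX ≤ iX ⁻¹ᵁ US) (hUY : UY = g ⁻¹ᵁ UX ⊓ iY ⁻¹ᵁ UT) :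
    iX.appLE US UX hUSX ≫ g.appLE UX UY (le_preimage_left_of_eq_inf hUY) =
      f.appLE US UT hUST ≫ iY.appLE UT UY (le_preimage_right_of_eq_inf hUY) := by
  simp only [Scheme.Hom.appLE_comp_appLE, w]

/-- Pointwise form of `appLE_comp_appLE_eq_of_comm_sq`. [cite: GortzWedhorn2020, Prop. 4.16 (pp. 101–104)] -/
theorem appLE_appLE_eq_of_comm_sq (w : g ≫ iX = iY ≫ f) (hUST : UT ≤ f ⁻¹ᵁ US)
    (hUSX : UX ≤ iX ⁻¹ᵁ US) (hUY : UY = g ⁻¹ᵁ UX ⊓ iY ⁻¹ᵁ UT) (r : Γ(S, US)) :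
    g.appLE UX UY (le_preimage_left_of_eq_inf hUY) (iX.appLE US UX hUSX r) =
      iY.appLE UT UY (le_preimage_right_of_eq_inf hUY) (f.appLE US UT hUST r) := by
  have h := congrArg (fun φ : Γ(S, US) ⟶ Γ(Y, UY) => φ r)
    (appLE_comp_appLE_eq_of_comm_sq w hUST hUSX hUY)
  simpa only [CommRingCat.comp_apply] using h

/-- The open `U_Y = g⁻¹U_X ∩ i_Y⁻¹U_T` of a cartesian square over three affine opens is affine
(it is `U_X ×_{U_S} U_T`). [cite: GortzWedhorn2020, Prop. 4.16 (pp. 101–104)] -/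
theorem isAffineOpen_of_isPullback_of_eq_inf (H : IsPullback g iY iX f) (hUS : IsAffineOpen US)
    (hUT : IsAffineOpen UT) (hUX : IsAffineOpen UX) (hUST : UT ≤ f ⁻¹ᵁ US) (hUSX : UX ≤ iX ⁻¹ᵁ US)
    (hUY : UY = g ⁻¹ᵁ UX ⊓ iY ⁻¹ᵁ UT) : IsAffineOpen UY := by
  have : IsAffine _ := hUS
  have : IsAffine _ := hUT
  have : IsAffine _ := hUX
  exact .of_isIso (Scheme.Hom.isPullback_resLE H hUST hUSX hUY).isoPullback.hom

/-- **The sections over three affine opens of a cartesian square form a pushout square of rings**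
(`Γ(U_Y) = Γ(U_T) ⊗_{Γ(U_S)} Γ(U_X)`; Mathlib's `isIso_pushoutSection_of_isAffineOpen` in the
unbundled `Algebra.IsPushout` form, for any algebra structures with the displayed structure maps).
[cite: GortzWedhorn2020, Prop. 4.16 and (4.8) (pp. 101–104)] -/
theorem isPushout_sections_of_isPullback (H : IsPullback g iY iX f) (hUS : IsAffineOpen US)
    (hUT : IsAffineOpen UT) (hUX : IsAffineOpen UX) (hUST : UT ≤ f ⁻¹ᵁ US) (hUSX : UX ≤ iX ⁻¹ᵁ US)
    (hUY : UY = g ⁻¹ᵁ UX ⊓ iY ⁻¹ᵁ UT)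
    [Algebra Γ(S, US) Γ(T, UT)] [Algebra Γ(S, US) Γ(X, UX)] [Algebra Γ(X, UX) Γ(Y, UY)]
    [Algebra Γ(T, UT) Γ(Y, UY)] [Algebra Γ(S, US) Γ(Y, UY)]
    [IsScalarTower Γ(S, US) Γ(X, UX) Γ(Y, UY)] [IsScalarTower Γ(S, US) Γ(T, UT) Γ(Y, UY)]
    (hf : algebraMap Γ(S, US) Γ(T, UT) = (f.appLE US UT hUST).hom)
    (hiX : algebraMap Γ(S, US) Γ(X, UX) = (iX.appLE US UX hUSX).hom)
    (hg : algebraMap Γ(X, UX) Γ(Y, UY) = (g.appLE UX UY (le_preimage_left_of_eq_inf hUY)).hom)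
    (hiY : algebraMap Γ(T, UT) Γ(Y, UY) = (iY.appLE UT UY (le_preimage_right_of_eq_inf hUY)).hom) :
    Algebra.IsPushout Γ(S, US) Γ(T, UT) Γ(X, UX) Γ(Y, UY) := by
  have h := (isIso_pushoutSection_iff H hUST hUSX hUY).mp
    (isIso_pushoutSection_of_isAffineOpen H hUST hUSX hUY hUS hUT hUX)
  rw [← CommRingCat.ofHom_hom (iX.appLE US UX hUSX), ← CommRingCat.ofHom_hom (f.appLE US UT hUST),
    ← CommRingCat.ofHom_hom (g.appLE UX UY _), ← CommRingCat.ofHom_hom (iY.appLE UT UY _),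
    ← hf, ← hiX, ← hg, ← hiY] at h
  exact (CommRingCat.isPushout_iff_isPushout.mp h).symm

end Square

section Sections

variable {X Y S T : Scheme.{u}} {f : T ⟶ S} {g : Y ⟶ X} {iX : X ⟶ S} {iY : Y ⟶ T}
  {US : S.Opens} {UT : T.Opens} {UX : X.Opens} {UY : Y.Opens}

/-- **Affine base change of sections of a quasi-coherent module.**  For a cartesian square
`g ≫ i_X = i_Y ≫ f` (`Y = X ×_S T`), affine opens `U_S ⊆ S`, `U_T ⊆ f⁻¹U_S`, `U_X ⊆ i_X⁻¹U_S`,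
`U_Y = g⁻¹U_X ∩ i_Y⁻¹U_T`, and an affine-localizing (e.g. quasi-coherent) `𝒪_X`-module `M`, the map
`Γ(U_T) ⊗_{Γ(U_S)} Γ(U_X, M) → Γ(U_Y, g^*M)`, `t ⊗ m ↦ t · η(m)|_{U_Y}`, is a `Γ(U_T)`-linear
isomorphism — for ANY algebra / module structures whose structure maps are `f♯`, `i_X♯`, `i_Y♯`
(hypotheses `hf`, `hiX`, `hiY`).  Proof: `Γ(U_Y) = Γ(U_T) ⊗_{Γ(U_S)} Γ(U_X)` (Mathlib
`isIso_pushoutSection_of_isAffineOpen`), `Γ(U_Y, g^*M) = Γ(U_Y) ⊗_{Γ(U_X)} Γ(U_X, M)` (the tree's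
`chartSectionsEquiv`), and `(Γ(U_T) ⊗_{Γ(U_S)} Γ(U_X)) ⊗_{Γ(U_X)} N = Γ(U_T) ⊗_{Γ(U_S)} N` (Mathlib
`Algebra.IsPushout.cancelBaseChange`).
[cite: GortzWedhorn2020, Prop. 7.24 (2) and Rem. 7.25] [cite: StacksProject, Tag 02KH (Lemma 30.5.2, flat/affine base change of sections)] -/
theorem exists_linearEquiv_tensor_sections_pullback (H : IsPullback g iY iX f) (hUS : IsAffineOpen US)
    (hUT : IsAffineOpen UT) (hUX : IsAffineOpen UX) (hUST : UT ≤ f ⁻¹ᵁ US) (hUSX : UX ≤ iX ⁻¹ᵁ US)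
    (hUY : UY = g ⁻¹ᵁ UX ⊓ iY ⁻¹ᵁ UT) (M : X.Modules) (hM : IsAffineLocalizing M)
    [Algebra Γ(S, US) Γ(T, UT)] (hf : algebraMap Γ(S, US) Γ(T, UT) = (f.appLE US UT hUST).hom)
    [Module Γ(S, US) Γ(M, UX)]
    (hiX : ∀ (r : Γ(S, US)) (m : Γ(M, UX)), r • m = iX.appLE US UX hUSX r • m)
    [Module Γ(T, UT) Γ((Scheme.Modules.pullback g).obj M, UY)]
    (hiY : ∀ (t : Γ(T, UT)) (n : Γ((Scheme.Modules.pullback g).obj M, UY)),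
      t • n = iY.appLE UT UY (le_preimage_right_of_eq_inf hUY) t • n) :
    ∃ e : Γ(T, UT) ⊗[Γ(S, US)] Γ(M, UX) ≃ₗ[Γ(T, UT)] Γ((Scheme.Modules.pullback g).obj M, UY),
      ∀ (t : Γ(T, UT)) (m : Γ(M, UX)),
        e (t ⊗ₜ m) = t • unitSectionLE g M (le_preimage_left_of_eq_inf hUY) m := by
  -- the four rings and their structure maps
  have hXY := le_preimage_left_of_eq_inf hUY
  have hTY := le_preimage_right_of_eq_inf hUY
  let φS : Γ(S, US) →+* Γ(T, UT) := (f.appLE US UT hUST).hom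
  let φX : Γ(S, US) →+* Γ(X, UX) := (iX.appLE US UX hUSX).hom
  let ψ : Γ(X, UX) →+* Γ(Y, UY) := (g.appLE UX UY hXY).hom
  let σ : Γ(T, UT) →+* Γ(Y, UY) := (iY.appLE UT UY hTY).hom
  have hsq : ∀ r, ψ (φX r) = σ (φS r) := fun r => appLE_appLE_eq_of_comm_sq H.w hUST hUSX hUY r
  have hf' : ∀ r, algebraMap Γ(S, US) Γ(T, UT) r = φS r := fun r => by rw [hf]
  letI : Algebra Γ(S, US) Γ(X, UX) := φX.toAlgebra
  letI : Algebra Γ(X, UX) Γ(Y, UY) := ψ.toAlgebra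
  letI : Algebra Γ(T, UT) Γ(Y, UY) := σ.toAlgebra
  letI : Algebra Γ(S, US) Γ(Y, UY) := (ψ.comp φX).toAlgebra
  haveI : IsScalarTower Γ(S, US) Γ(X, UX) Γ(Y, UY) := IsScalarTower.of_algebraMap_eq fun r => rfl
  haveI : IsScalarTower Γ(S, US) Γ(T, UT) Γ(Y, UY) := IsScalarTower.of_algebraMap_eq fun r => by
    change ψ (φX r) = σ (algebraMap Γ(S, US) Γ(T, UT) r)
    rw [hf', hsq]
  haveI : Algebra.IsPushout Γ(S, US) Γ(T, UT) Γ(X, UX) Γ(Y, UY) :=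
    isPushout_sections_of_isPullback H hUS hUT hUX hUST hUSX hUY hf rfl rfl rfl
  -- the module `Γ(U_X, M)` over `Γ(U_S)` (given) and `Γ(U_X)` (native), and the target over the four rings
  haveI : IsScalarTower Γ(S, US) Γ(X, UX) Γ(M, UX) := ⟨fun r a m => by
    rw [hiX, Algebra.smul_def, mul_smul]; rfl⟩
  let P : Type u := Γ((Scheme.Modules.pullback g).obj M, UY)
  letI : Module Γ(S, US) P := Module.compHom P (ψ.comp φX)
  haveI : IsScalarTower Γ(S, US) Γ(T, UT) P := ⟨fun r t p => by
    change (r • t) • p = (ψ (φX r)) • (t • p)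
    rw [hiY, hiY, Algebra.smul_def, hf', map_mul, mul_smul, hsq]⟩
  haveI : SMulCommClass Γ(S, US) Γ(T, UT) P := ⟨fun r t p => by
    change (ψ (φX r)) • (t • p) = t • ((ψ (φX r)) • p)
    rw [hiY, hiY, ← mul_smul, ← mul_smul, mul_comm]⟩
  haveI : SMulCommClass Γ(T, UT) Γ(S, US) P := SMulCommClass.symm _ _ _
  haveI : SMulCommClass Γ(X, UX) Γ(T, UT) Γ(Y, UY) := ⟨fun a t b => by
    simp only [Algebra.smul_def]; ring⟩
  -- `η : m ↦ η(m)|_{U_Y}` is `Γ(U_S)`-linear and the candidate map `Φ : t ⊗ m ↦ t • η m`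
  let η : Γ(M, UX) →ₗ[Γ(S, US)] P :=
    { toFun := unitSectionLE g M hXY
      map_add' := unitSectionLE_add g M hXY
      map_smul' := fun r m => by
        rw [hiX, unitSectionLE_smul]
        rfl }
  let Φ : Γ(T, UT) ⊗[Γ(S, US)] Γ(M, UX) →ₗ[Γ(T, UT)] P :=
    TensorProduct.AlgebraTensorModule.lift
      (LinearMap.mk₂' Γ(T, UT) Γ(S, US) (fun (t : Γ(T, UT)) (m : Γ(M, UX)) => t • η m)
        (fun t t' m => add_smul t t' (η m)) (fun c t m => by rw [smul_eq_mul, mul_smul])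
        (fun t m m' => by rw [map_add, smul_add]) (fun c t m => by rw [map_smul, smul_comm]))
  have hΦ : ∀ t m, Φ (t ⊗ₜ m) = t • unitSectionLE g M hXY m := fun t m => by
    simp only [Φ, TensorProduct.AlgebraTensorModule.lift_apply]
    rfl
  -- the three known bijections whose composite is `Φ`
  have hUYaff : IsAffineOpen UY := isAffineOpen_of_isPullback_of_eq_inf H hUS hUT hUX hUST hUSX hUY
  let ψ₁ := (Algebra.IsPushout.cancelBaseChange Γ(S, US) Γ(T, UT) Γ(X, UX) Γ(Y, UY) Γ(M, UX)).symm
  let eB : Γ(Y, UY) ≃ₗ[Γ(X, UX)] (ModuleCat.restrictScalars ψ).obj (ModuleCat.of Γ(Y, UY) Γ(Y, UY)) :=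
    { toFun := fun b => b
      invFun := fun b => b
      map_add' := fun _ _ => rfl
      map_smul' := fun _ _ => rfl
      left_inv := fun _ => rfl
      right_inv := fun _ => rfl }
  let ψ₂ := TensorProduct.congr eB (appTopRestrictFromSpecEquiv M hUX)
  let ψ₃ := chartSectionsEquiv g M hUX hUYaff hXY hM
  have hcomp : ∀ x, Φ x = ψ₃ (ψ₂ (ψ₁ x)) := fun x => by
    induction x using TensorProduct.induction_on with
    | zero => simp only [map_zero]
    | tmul t m =>
      rw [hΦ, hiY]
      change _ = ψ₃ (ψ₂ ((Algebra.IsPushout.cancelBaseChange Γ(S, US) Γ(T, UT) Γ(X, UX) Γ(Y, UY)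
        Γ(M, UX)).symm (t ⊗ₜ m)))
      rw [Algebra.IsPushout.cancelBaseChange_symm_tmul]
      change _ = ψ₃ (ψ₂ (σ t ⊗ₜ m))
      have h2 : ψ₂ (σ t ⊗ₜ m) =
          (σ t ⊗ₜ[Γ(X, UX), (chartHom g hXY).hom] appTopRestrictFromSpecEquiv M hUX m :
            chartTensor g M hUX hXY) :=
        TensorProduct.congr_tmul _ _ _ _
      have h3 := chartSectionsEquiv_tmul g hUX hUYaff hXY hM (σ t) m
      rw [h2]
      exact h3.symm
    | add x y hx hy => simp only [map_add, hx, hy]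
  have hbij : Function.Bijective Φ := by
    have : (Φ : _ → P) = ψ₃ ∘ ψ₂ ∘ ψ₁ := funext hcomp
    rw [this]
    exact ψ₃.bijective.comp (ψ₂.bijective.comp ψ₁.bijective)
  exact ⟨LinearEquiv.ofBijective Φ hbij, fun t m => hΦ t m⟩

end Sections

section Naturality

variable {X Y S T : Scheme.{u}} {f : T ⟶ S} {g : Y ⟶ X} {iX : X ⟶ S} {iY : Y ⟶ T}
  {US : S.Opens} {UT : T.Opens} {UX UX' : X.Opens} {UY UY' : Y.Opens}

/-- **Pulled-back sections commute with restriction**: for `U_X' ⊆ U_X` and `U_Y' ⊆ U_Y` (with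
`U_Y ⊆ g⁻¹U_X`, `U_Y' ⊆ g⁻¹U_X'`), `η(m|_{U_X'})|_{U_Y'} = (η(m)|_{U_Y})|_{U_Y'}`. [cite: GortzWedhorn2020, Prop. 7.24 (2)] -/
theorem unitSectionLE_map_of_le (M : X.Modules) (hXY : UY ≤ g ⁻¹ᵁ UX) (hXY' : UY' ≤ g ⁻¹ᵁ UX')
    (k : UX' ≤ UX) (j : UY' ≤ UY) (m : Γ(M, UX)) :
    unitSectionLE g M hXY' (M.presheaf.map (homOfLE k).op m) =
      ((Scheme.Modules.pullback g).obj M).presheaf.map (homOfLE j).op (unitSectionLE g M hXY m) := by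
  rw [unitSectionLE, unitSectionLE, unitSection_map, ← CategoryTheory.comp_apply, ← Functor.map_comp,
    ← CategoryTheory.comp_apply, ← Functor.map_comp]
  rfl

/-- **Naturality of the affine base change in the open of `X`.**  For `U_X' ⊆ U_X` (opens of `X`
over `U_S`) with `U_Y = g⁻¹U_X ∩ i_Y⁻¹U_T`, `U_Y' = g⁻¹U_X' ∩ i_Y⁻¹U_T`, any two `Γ(U_T)`-linear
maps `e`, `e'` pinned by the formula `t ⊗ m ↦ t · η(m)|` (e.g. the isomorphisms of
`exists_linearEquiv_tensor_sections_pullback`) and any `Γ(U_S)`-linear `ρ` computing the restriction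
`Γ(U_X, M) → Γ(U_X', M)` satisfy `e(x)|_{U_Y'} = e'((1 ⊗ ρ) x)` — so the termwise isomorphisms over a
finite affine cover `s ↦ U_{X,s}` form a morphism of (ordered) Čech complexes.
[cite: GortzWedhorn2020, Prop. 7.24 (2) and Rem. 7.25] -/
theorem map_tensor_sections_pullback_natural (hUY : UY = g ⁻¹ᵁ UX ⊓ iY ⁻¹ᵁ UT) (hUY' : UY' = g ⁻¹ᵁ UX' ⊓ iY ⁻¹ᵁ UT) (k : UX' ≤ UX)
    (M : X.Modules) [Algebra Γ(S, US) Γ(T, UT)] [Module Γ(S, US) Γ(M, UX)] [Module Γ(S, US) Γ(M, UX')]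
    [Module Γ(T, UT) Γ((Scheme.Modules.pullback g).obj M, UY)]
    [Module Γ(T, UT) Γ((Scheme.Modules.pullback g).obj M, UY')]
    (hiY : ∀ (t : Γ(T, UT)) (n : Γ((Scheme.Modules.pullback g).obj M, UY)),
      t • n = iY.appLE UT UY (le_preimage_right_of_eq_inf hUY) t • n)
    (hiY' : ∀ (t : Γ(T, UT)) (n : Γ((Scheme.Modules.pullback g).obj M, UY')),
      t • n = iY.appLE UT UY' (le_preimage_right_of_eq_inf hUY') t • n)
    (ρ : Γ(M, UX) →ₗ[Γ(S, US)] Γ(M, UX')) (hρ : ∀ m, ρ m = M.presheaf.map (homOfLE k).op m)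
    (e : Γ(T, UT) ⊗[Γ(S, US)] Γ(M, UX) →ₗ[Γ(T, UT)] Γ((Scheme.Modules.pullback g).obj M, UY))
    (he : ∀ (t : Γ(T, UT)) (m : Γ(M, UX)),
      e (t ⊗ₜ m) = t • unitSectionLE g M (le_preimage_left_of_eq_inf hUY) m)
    (e' : Γ(T, UT) ⊗[Γ(S, US)] Γ(M, UX') →ₗ[Γ(T, UT)] Γ((Scheme.Modules.pullback g).obj M, UY'))
    (he' : ∀ (t : Γ(T, UT)) (m : Γ(M, UX')),
      e' (t ⊗ₜ m) = t • unitSectionLE g M (le_preimage_left_of_eq_inf hUY') m)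
    (x : Γ(T, UT) ⊗[Γ(S, US)] Γ(M, UX)) :
    haveI j : UY' ≤ UY := hUY'.trans_le (le_trans (inf_le_inf_right _ (Scheme.Hom.preimage_mono g k))
      hUY.symm.le)
    ((Scheme.Modules.pullback g).obj M).presheaf.map (homOfLE j).op (e x) =
      e' (TensorProduct.map LinearMap.id ρ x) := by
  have j : UY' ≤ UY := hUY'.trans_le (le_trans (inf_le_inf_right _ (Scheme.Hom.preimage_mono g k))
    hUY.symm.le)
  induction x using TensorProduct.induction_on with
  | zero => simp only [map_zero]
  | tmul t m =>
    rw [TensorProduct.map_tmul, LinearMap.id_apply, he, he', hρ, hiY, hiY', Scheme.Modules.map_smul,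
      unitSectionLE_map_of_le M (le_preimage_left_of_eq_inf hUY) (le_preimage_left_of_eq_inf hUY') k j,
      ← CategoryTheory.comp_apply, Scheme.Hom.appLE_map]
  | add x y hx hy => simp only [map_add, hx, hy]

end Naturality

end Literature.AlgebraicGeometry.Modules

end
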